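import Summits.RiemannHypothesis.RiemannHypothesis.Theorems.SignConeConeMagnificationTranslate
import Literature.NumberTheory.LFunctions.WeilGroundEnergyProofs
import Literature.NumberTheory.LFunctions.WeilArchimedeanPositivityProofs

/-!
# The positive-definiteness lever for autocorrelation sums
(route `SignCone`, item stmt-RiemannHypothesis-16302 `SignConeOscillatory`; HELPER file, `--supports`)

For a Weil test `g` with autocorrelation `G = g ⋆ g̃` (`G(t) = ∫ g(v) conj g(v - t) dv`) and real `t, u`,
the symmetric second difference of `G` is itself an autocorrelation,

  `2 G(t) - G(t + u) - G(t - u) = ((g - g_u) ⋆ (g - g_u)~)(t)`,  `g_u(v) = g(v - u)`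

(`weilConv_weilReflect_second_difference`, from the polarised translation formula
`weilConv_weilReflect_translateMix`), so Bombieri's Lemma 2 (`norm_weilConv_weilReflect_le`: an
autocorrelation is bounded by its value at `0`) gives the LEVER

  `‖2 G(t) - G(t + u) - G(t - u)‖ ≤ ‖g - g_u‖₂² = 2 (Re G(0) - Re G(u))`   (`norm_second_difference_le`)

and, summed over a finite family, `2 Re F(t) - Re F(t + u) - Re F(t - u) ≥ -2 (Re F(0) - Re F(u))` for
`F = Σᵢ gᵢ ⋆ g̃ᵢ` (`neg_two_mul_deficit_le`). Use (file `SignConeSignConeOscillatoryShortExcursion`): a dip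
`Re F(t₀) = -D` flanked by two points `t₀ ± u` where `Re F ≥ 0` forces the near-origin DEFICIT
`Re F(0) - Re F(u) ≥ D` — linear in the depth `D` (Krein's inequality `|F(x) - F(y)|² ≤ 2F(0)(F(0) - Re F(x-y))`
would only give `D²/(2F(0))`). This is the first place in the route's unconditional theorems where
positive-definiteness is used beyond the bound `|F| ≤ F(0)`.
-/

noncomputable section

-- `Summit.RiemannHypothesis.RiemannHypothesis.…` repeats a namespace component by design (D-0017 layout).
set_option linter.dupNamespace false

open scoped BigOperators ComplexConjugate
open Complex MeasureTheory Set Filter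

namespace Summit.RiemannHypothesis.RiemannHypothesis.Theorems.SignCone

open Literature.NumberTheory.LFunctions
open Literature.NumberTheory.LFunctions.WeilConverse

variable {g : ℝ → ℂ}

/-- The autocorrelation of the difference `g - g_u` (`g_u(v) = g(v - u)`, i.e. `translateMix g (-1) u`) is the
symmetric second difference of `G = g ⋆ g̃`: `((g - g_u) ⋆ (g - g_u)~)(t) = 2 G(t) - G(t + u) - G(t - u)`. [folklore] -/
theorem weilConv_weilReflect_second_difference (hg : IsWeilTest g) (u t : ℝ) :
    weilConv (translateMix g (-1) u) (weilReflect (translateMix g (-1) u)) t =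
      2 * weilConv g (weilReflect g) t - weilConv g (weilReflect g) (t + u) -
        weilConv g (weilReflect g) (t - u) := by
  rw [weilConv_weilReflect_translateMix hg (-1) u t]
  have h1 : Complex.normSq (-1 : ℂ) = 1 := by simp
  have h2 : (starRingEnd ℂ) (-1 : ℂ) = -1 := by simp
  rw [h1, h2]
  push_cast
  ring

/-- Real part of twice a complex number. [folklore] -/
private lemma re_two_mul (z : ℂ) : (2 * z).re = 2 * z.re := by
  simp [Complex.mul_re]

/-- **The lever (one test function).** For a Weil test `g`, `G = g ⋆ g̃` and all real `t, u`:
`‖2 G(t) - G(t + u) - G(t - u)‖ ≤ 2 (Re G(0) - Re G(u))` — the modulus of the autocorrelation of `g - g_u`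
at `t` is at most its value at `0` (Bombieri 2000, Lemma 2), which is
`‖g - g_u‖₂² = 2 G(0) - G(u) - G(-u) = 2 (Re G(0) - Re G(u))`. [folklore] -/
theorem norm_second_difference_le (hg : IsWeilTest g) (t u : ℝ) :
    ‖2 * weilConv g (weilReflect g) t - weilConv g (weilReflect g) (t + u) -
        weilConv g (weilReflect g) (t - u)‖ ≤
      2 * ((weilConv g (weilReflect g) 0).re - (weilConv g (weilReflect g) u).re) := by
  have hd : IsWeilTest (translateMix g (-1) u) := isWeilTest_translateMix hg (-1) u
  have h1 := norm_weilConv_weilReflect_le hd t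
  rw [weilConv_weilReflect_second_difference hg u t] at h1
  have h0 : ((∫ v : ℝ, ‖translateMix g (-1) u v‖ ^ 2 : ℝ) : ℂ) =
      2 * weilConv g (weilReflect g) 0 - weilConv g (weilReflect g) (0 + u) -
        weilConv g (weilReflect g) (0 - u) := by
    rw [← weilConv_weilReflect_apply_zero, weilConv_weilReflect_second_difference hg u 0]
  have h0re : (∫ v : ℝ, ‖translateMix g (-1) u v‖ ^ 2) =
      2 * (weilConv g (weilReflect g) 0).re - (weilConv g (weilReflect g) u).re -
        (weilConv g (weilReflect g) (-u)).re := by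
    have h := congrArg Complex.re h0
    rw [Complex.ofReal_re, zero_add, zero_sub, Complex.sub_re, Complex.sub_re, re_two_mul] at h
    exact h
  have hneg : (weilConv g (weilReflect g) (-u)).re = (weilConv g (weilReflect g) u).re := by
    rw [weilConv_weilReflect_neg, Complex.conj_re]
  linarith [h1, h0re, hneg]

/-- **The lever, real form (one test function)**: `2 Re G(t) - Re G(t + u) - Re G(t - u) ≥ -2 (Re G(0) - Re G(u))`. [folklore] -/
theorem neg_two_mul_deficit_le_single (hg : IsWeilTest g) (t u : ℝ) :
    -(2 * ((weilConv g (weilReflect g) 0).re - (weilConv g (weilReflect g) u).re)) ≤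
      2 * (weilConv g (weilReflect g) t).re - (weilConv g (weilReflect g) (t + u)).re -
        (weilConv g (weilReflect g) (t - u)).re := by
  have h := norm_second_difference_le hg t u
  have hre := Complex.abs_re_le_norm (2 * weilConv g (weilReflect g) t - weilConv g (weilReflect g) (t + u) -
    weilConv g (weilReflect g) (t - u))
  rw [Complex.sub_re, Complex.sub_re, re_two_mul] at hre
  have h2 := (abs_le.1 (hre.trans h)).1
  linarith

/-- **The lever for autocorrelation sums.** For Weil tests `gᵢ` and `F = Σᵢ gᵢ ⋆ g̃ᵢ`, for all real `t, u`:
`-2 (Re F(0) - Re F(u)) ≤ 2 Re F(t) - Re F(t + u) - Re F(t - u)`. In particular a point `t` with `Re F(t) ≤ -D`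
whose two flanks `t ± u` have `Re F(t ± u) ≥ 0` forces the near-origin deficit `Re F(0) - Re F(u) ≥ D`. [folklore] -/
theorem neg_two_mul_deficit_le {k : ℕ} {g : Fin k → ℝ → ℂ} (hg : ∀ i, IsWeilTest (g i)) {F : ℝ → ℂ}
    (hF : F = fun t => ∑ i, weilConv (g i) (weilReflect (g i)) t) (t u : ℝ) :
    -(2 * ((F 0).re - (F u).re)) ≤ 2 * (F t).re - (F (t + u)).re - (F (t - u)).re := by
  subst hF
  simp only [Complex.re_sum]
  have key : ∀ i, -(2 * ((weilConv (g i) (weilReflect (g i)) 0).re - (weilConv (g i) (weilReflect (g i)) u).re)) ≤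
      2 * (weilConv (g i) (weilReflect (g i)) t).re - (weilConv (g i) (weilReflect (g i)) (t + u)).re -
        (weilConv (g i) (weilReflect (g i)) (t - u)).re := fun i => neg_two_mul_deficit_le_single (hg i) t u
  calc -(2 * (∑ i, (weilConv (g i) (weilReflect (g i)) 0).re - ∑ i, (weilConv (g i) (weilReflect (g i)) u).re))
      = ∑ i, -(2 * ((weilConv (g i) (weilReflect (g i)) 0).re - (weilConv (g i) (weilReflect (g i)) u).re)) := by
        rw [← Finset.sum_sub_distrib, Finset.mul_sum, ← Finset.sum_neg_distrib]
    _ ≤ ∑ i, (2 * (weilConv (g i) (weilReflect (g i)) t).re - (weilConv (g i) (weilReflect (g i)) (t + u)).re -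
        (weilConv (g i) (weilReflect (g i)) (t - u)).re) := Finset.sum_le_sum fun i _ => key i
    _ = 2 * ∑ i, (weilConv (g i) (weilReflect (g i)) t).re - ∑ i, (weilConv (g i) (weilReflect (g i)) (t + u)).re -
        ∑ i, (weilConv (g i) (weilReflect (g i)) (t - u)).re := by
        rw [Finset.mul_sum, ← Finset.sum_sub_distrib, ← Finset.sum_sub_distrib]

/-- **Deficit from a flanked dip.** For `F = Σᵢ gᵢ ⋆ g̃ᵢ`: if `Re F(t) ≤ -D` and `Re F(t + u) ≥ 0`, `Re F(t - u) ≥ 0`,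
then `Re F(u) ≤ Re F(0) - D`. [folklore] -/
theorem re_le_re_zero_sub_of_dip {k : ℕ} {g : Fin k → ℝ → ℂ} (hg : ∀ i, IsWeilTest (g i)) {F : ℝ → ℂ}
    (hF : F = fun t => ∑ i, weilConv (g i) (weilReflect (g i)) t) {t u D : ℝ} (ht : (F t).re ≤ -D)
    (hp : 0 ≤ (F (t + u)).re) (hm : 0 ≤ (F (t - u)).re) : (F u).re ≤ (F 0).re - D := by
  have h := neg_two_mul_deficit_le hg hF t u
  linarith

/-- **Registered form of the lever** (sub-goal `stub_pdLever` of item stmt-RiemannHypothesis-16302): for Weil tests `gᵢ`,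
`F = Σᵢ gᵢ ⋆ g̃ᵢ` and real `t, u`: `−2(Re F(0) − Re F(u)) ≤ 2 Re F(t) − Re F(t+u) − Re F(t−u)`. [folklore] -/
theorem stub_pdLever : ∀ (k : ℕ) (g : Fin k → ℝ → ℂ), (∀ i, IsWeilTest (g i)) → ∀ t u : ℝ, -(2 * ((∑ i, weilConv (g i) (weilReflect (g i)) 0).re - (∑ i, weilConv (g i) (weilReflect (g i)) u).re)) ≤ 2 * (∑ i, weilConv (g i) (weilReflect (g i)) t).re - (∑ i, weilConv (g i) (weilReflect (g i)) (t + u)).re - (∑ i, weilConv (g i) (weilReflect (g i)) (t - u)).re :=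
  fun _ _ hg t u => neg_two_mul_deficit_le hg rfl t u

end Summit.RiemannHypothesis.RiemannHypothesis.Theorems.SignCone

end
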